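import Summits.Ventures.CertifiedManyBodySolver.Theorems.M3PrimeEdgeSplitLowerEdge_ge_m4o5SlackAbsorb
import Summits.Ventures.CertifiedManyBodySolver.Theorems.M3x2EdgeSplitLowerEdge_ge_m83o100WardWindowSound
import HarnessLib

/-!
# The slack reader of the `M3x2EdgeSplit.LowerEdge_ge_m83o100` skeleton of record: `stub_slackAbsorb` DISCHARGED

HONEST FRAMING: first certified bounds; not a superconductivity verdict; NO number and no crux/summit statement is proved
here. The −83/100 item's registered skeleton (`Cruxes/LowerEdge_ge_m83o100/Lines/fo_dual_rounding.lean`, sha 74e9a7f66a0c,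
pen hub-lb-dual-plan-2; item stmt-Ventures-22024) carries the SAME stub 2 `stub_slackAbsorb : WardD4WindowSound →
WardSlackWindowBound` (verbatim text) as the −4/5 item's. Its statement texts in this item's namespace
(`Theorems.WardSlotM83.WardD4WindowSound`, landed p612562) are rfl-equal to the −4/5 copies (`Theorems.WardSlot.…`), so the
discharge is a one-line re-export of `Theorems.WardSlot.stub_slackAbsorb` (proof: hub-lb-sym-ref-1, landed by
hub-lb-sym-eng-3); `WardSlackWindowBound` is taken from `Theorems.WardSlot` by `open` (no new definition). After this the
−83/100 skeleton retains ONE stub: the value statement `stub_nearCert_m83o100` (met BY VALUE by CERTIFIED #529, whose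
kernel replay is XL). A certified bound is a number with a certificate; nothing here predicts superconductivity.
-/

noncomputable section

namespace Summit.Ventures.CertifiedManyBodySolver.Theorems.WardSlotM83

open Summit.Ventures.CertifiedManyBodySolver.Theorems.WardSlot (WardSlackWindowBound)

/-- **Stub 2 of the −83/100 skeleton of record, DISCHARGED** — slack absorption `WardD4WindowSound →
WardSlackWindowBound` (Jansson–Chaykin–Keil Lemma 3.1 in the window algebra), re-exported from the −4/5 item's
`Theorems.WardSlot.stub_slackAbsorb` (the statement copies are rfl-equal). [cite: JanssonChaykinKeil2008, Lemma 3.1] -/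
theorem stub_slackAbsorb : WardD4WindowSound → WardSlackWindowBound :=
  fun h => Summit.Ventures.CertifiedManyBodySolver.Theorems.WardSlot.stub_slackAbsorb h

end Summit.Ventures.CertifiedManyBodySolver.Theorems.WardSlotM83

end
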